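import Summits.NavierStokesRegularity.NavierStokesRegularity.Theorems.ScenarioCensusRowF1IntStretchTransfer
import Summits.NavierStokesRegularity.NavierStokesRegularity.Theorems.ScenarioCensusRowF1FrozenTop
import HarnessLib

/-!
# LINE «integrated-stretch» port, part 4/5: §6 THE KILL (the stretching-certificate Liouville theorem at `θ = 0`, BY NAME from the stretched-top port); §7 the integrated
# production rows — `Row_F1ip` / `rowF1ip_holds`, the floor `DivergentProduction`, the residual `IpSlack` (≡ `Row_F1`), dictionary, displays

Re-homed for the scenario census (typer seat ns-census-typer-1 g8; the cells F1ip / F1ipb and the floors DP / DX are MEMBERS OF RECORD «DECIDED IN KERNEL IN FILES» of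
row F1 since census v1.76 (critic idea-crit-3 g7 PASS — no price 01:59:32Z; ref ns-census-ref g10 PRE-CHECK ✓ §15.8–10; lead-presearch label); this port makes them
TREE-decided): VERBATIM PORT of ns-idea-3 LINE 23 «integrated-stretch», `pub/ideators/ns-idea-3/lines/integrated-stretch/line-integrated-stretch.lean` sha16
1cd526fed4663244 (1567 l., lean check rc 0, 0 sorry), split for the 400-line rule into `ScenarioCensusRowF1IntStretch` (§1–§2) → `…IntStretchZoom` (§3–§5a) →
`…IntStretchTransfer` (§5b) → `…IntStretchKill` (§6–§7) → `…IntStretchBudget` (§8 + census KEYS).  Lean text VERBATIM in namespace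
`…Theorems.ScenarioCensus.IntegratedStretch` (the line's `…Cruxes.ScenarioCensusRowF1.IntegratedStretchLine` re-homed); port edits: the bracket lines `section
IntegralTransfer` / `end IntegralTransfer` dropped (no `variable`s; the section spans two parts), `@[conjecture]` on the residual `IpSlack` (≡ `ScenarioCensus.Row_F1`,
OPEN), four one-line docstrings added (gate lint); lemmas the line shares VERBATIM with the landed inviscid-top / frozen-top / columnar-top / stretched-top ports are
taken BY NAME (listed below).  Statements untouched.

No census VALUE is moved here (row F1 stays OPEN-WITH-LINE; the members become TREE-decided by name); NS regularity is NOT proved; `Row_F1` is untouched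
(zero movement, `ipSlack_iff_rowF1`); no summit statement is proved by this file. Lemmas that restate already-landed tree declarations are taken BY NAME (gate lint `dedup.landed`): `fderiv_smul_stPull_apply` = `InviscidTop.fderiv_smul_stPull_apply`, `fderiv_smul_stPull` = `InviscidTop.fderiv_smul_stPull`, `fderiv_fderiv_smul_stPull` = `InviscidTop.fderiv_fderiv_smul_stPull`, `tendsto_clm_of_tendsto_apply` = `InviscidTop.tendsto_clm_of_tendsto_apply`, `tendsto_fderiv_fderiv_apply_of_bound` = `InviscidTop.tendsto_fderiv_fderiv_apply_of_bound`, `tendsto_fderiv_fderiv_of_bound` = `InviscidTop.tendsto_fderiv_fderiv_of_bound`, `tendsto_fderiv_fderiv_of_typeI_seq_Ioo` = `InviscidTop.tendsto_fderiv_fderiv_of_typeI_seq_Ioo`, `sing_of_not_bounded` = `InviscidTop.sing_of_not_bounded`, `convect_curl_self` = `FrozenTop.convect_curl_self`, `fderiv3_smul_stPull` = `FrozenTop.fderiv3_smul_stPull`, `tendsto_fderiv3_of_typeI_seq_Ioo` = `FrozenTop.tendsto_fderiv3_of_typeI_seq_Ioo`, `radius_eq` = `FrozenTop.radius_eq`,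 `jointCond_everywhere₆` = `FrozenTop.jointCond_everywhere₄`, `tendsto_physicalTime` = `ColumnarTop.tendsto_physicalTime`, `eventually_fast` = `ColumnarTop.eventually_fast`, `sqrt_timeLag` = `StretchedTop.sqrt_timeLag`, `forall_of_forall_ne_zero` = `StretchedTop.forall_of_forall_ne_zero`, `cert_ineq_of_stretching` = `StretchedTop.cert_ineq_of_stretching`, `typeI_ancient_eq_zero_of_subcriticalStretching` = `StretchedTop.typeI_ancient_eq_zero_of_subcriticalStretching`, `exists_singularZoom_package₃` = `FrozenTop.exists_singularZoom_package₃`, `lapD_eq_zero_of_eq_zero` = `FrozenTop.lapD_eq_zero_of_eq_zero`.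
-/

-- the summit and its single problem share the name `NavierStokesRegularity` (D-0017 nested layout)
set_option linter.dupNamespace false

noncomputable section

open MeasureTheory Set Function Filter TopologicalSpace Metric
open scoped Topology NNReal ENNReal InnerProductSpace RealInnerProductSpace Laplacian

namespace Summit.NavierStokesRegularity.NavierStokesRegularity.Theorems.ScenarioCensus.IntegratedStretch

open Literature.Analysis Literature.Analysis.FluidPDE
open Summit.NavierStokesRegularity.NavierStokesRegularity.Theorems

/-! ## §6 THE KILL — the tree's stretching-certificate Liouville theorem at `θ = 0` (LINE 16's bridge, re-proved
verbatim): a Type-I ancient mild field whose vorticity is nowhere stretched super-critically vanishes -/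

-- `cert_ineq_of_stretching`: the line restates the tree's `StretchedTop.cert_ineq_of_stretching`; taken BY NAME (gate lint dedup.landed).

-- `typeI_ancient_eq_zero_of_subcriticalStretching`: the line restates the tree's `StretchedTop.typeI_ancient_eq_zero_of_subcriticalStretching`; taken BY NAME (gate lint dedup.landed).

/-- **NON-STRETCHING TYPE-I ANCIENT SOLUTIONS ARE TRIVIAL** (the kill in the production convention, `θ = 0`): `W ∈ 𝒦_C`
with `⟪curl W, (curl W·∇) W⟫ ≤ 0` on the open past vanishes. -/
theorem nonStretching_ancient_trivial {C : ℝ} {W : ℝ → E3 → E3} (hW : IsTypeIAncientMild C W)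
    (h : ∀ s < (0 : ℝ), ∀ y : E3, ⟪curl (W s) y, convect (curl (W s)) (W s) y⟫ ≤ 0) :
    ∀ s < (0 : ℝ), ∀ y : E3, W s y = 0 :=
  StretchedTop.typeI_ancient_eq_zero_of_subcriticalStretching zero_lt_one hW fun s hs y => by
    rw [zero_mul, stretch_eq' (W s) y, ← stretch_eq (W s) y]
    exact mul_nonpos_iff.2 (Or.inl ⟨(neg_pos.2 hs).le, h s hs y⟩)

/-! ## §7 The INTEGRATED PRODUCTION rows: the number, the row `F1ip`, the floor DIVERGENT PRODUCTION, the residual;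
the row is EXCLUDED (`rowF1ip_holds`); residual ≡ `Row_F1` -/

/-- The number of the line — the **ENSTROPHY-PRODUCTION INTEGRAND OF THE FAST FLUID**:
`𝟙{t ∈ [0,T), Λ(t) < |u(t,x)|} · √(T − t) · max(0, ⟪ω, (ω·∇)u⟫(t, x))`, `ω = curl u` (`⟪ω, (ω·∇)u⟫ = ⟪ω, Sω⟫`: vortex
stretching; ONE-SIDED — compression is free, only production is charged; KINEMATIC — no pressure, no viscosity, no time
derivative). -/
def productionIntegrand (T : ℝ) (Λ : ℝ → ℝ) (u : ℝ → E3 → E3) : ℝ × E3 → ℝ≥0∞ :=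
  {z : ℝ × E3 | z.1 ∈ Ico 0 T ∧ Λ z.1 < ‖u z.1 z.2‖}.indicator fun z =>
    ENNReal.ofReal (Real.sqrt (T - z.1) * max 0 ⟪curl (u z.1) z.2, convect (curl (u z.1)) (u z.1) z.2⟫)

/-- **INTEGRABLY STRETCHED TOP** at the level `Λ`: `∬_{|u| > Λ(t)} √(T − t) [⟪ω, Sω⟫]₊ dx dt < ∞` (lower Lebesgue
integral over `ℝ × ℝ³`; the indicator restricts to `[0, T)`).  PARAMETER-FREE. -/
def HasIntegrablyStretchedTop (T : ℝ) (Λ : ℝ → ℝ) (u : ℝ → E3 → E3) : Prop :=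
  ∫⁻ z, productionIntegrand T Λ u z < ⊤

/-- **Criterion row F1ip** (the exact frame of `Row_F1` plus ONE hypothesis: an integrably stretched top at some
MEASURABLE subcritical level).  PROVED (`rowF1ip_holds`). -/
def Row_F1ip : Prop :=
  ∀ (ν T : ℝ), 0 < ν → 0 < T → ∀ (u : ℝ → E3 → E3) (p : ℝ → E3 → ℝ),
    IsClassicalNSSolutionOn (Ico 0 T) ν 0 u p → IsLerayHopfOn T ν 0 (u 0) u →
    HasRapidSpatialDecay (u 0) → IsTypeIBlowup u T →
    (∃ Λ : ℝ → ℝ, IsSubcriticalLevel T Λ ∧ Measurable Λ ∧ HasIntegrablyStretchedTop T Λ u) →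
    HasSmoothExtensionPast ν 0 u T

/-- **DIVERGENT PRODUCTION** (structural floor, maximal frame): a maximal Type-I Clay blow-up produces enstrophy
NON-INTEGRABLY (against `√(T − t)`) on the fast set of EVERY measurable subcritical speed level:
`∬_{|u| > Λ(t)} √(T − t) [⟪ω, Sω⟫]₊ dx dt = ∞`.  PROVED (`divergentProduction_holds`). -/
def DivergentProduction : Prop :=
  ∀ (ν T : ℝ), 0 < ν → 0 < T → ∀ (u : ℝ → E3 → E3) (p : ℝ → E3 → ℝ),
    IsMaximalSmoothSolution ν 0 u p T → IsLerayHopfOn T ν 0 (u 0) u →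
    HasRapidSpatialDecay (u 0) → IsTypeIBlowup u T →
    ∀ Λ : ℝ → ℝ, IsSubcriticalLevel T Λ → Measurable Λ → ∫⁻ z, productionIntegrand T Λ u z = ⊤

/-- **Residual** (maximal frame): every maximal Type-I Clay blow-up has an integrably stretched top at some measurable
subcritical level.  DECLARED ≡ row F1 (`ipSlack_iff_rowF1`); no movement on `Row_F1` is claimed. -/
@[conjecture] def IpSlack : Prop :=
  ∀ (ν T : ℝ), 0 < ν → 0 < T → ∀ (u : ℝ → E3 → E3) (p : ℝ → E3 → ℝ),
    IsMaximalSmoothSolution ν 0 u p T → IsLerayHopfOn T ν 0 (u 0) u →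
    HasRapidSpatialDecay (u 0) → IsTypeIBlowup u T →
    ∃ Λ : ℝ → ℝ, IsSubcriticalLevel T Λ ∧ Measurable Λ ∧ HasIntegrablyStretchedTop T Λ u

/-- **The split**: criterion + residual ⇒ row F1 (by cases on extendability). -/
theorem rowF1_of (hD : Row_F1ip) (hR : IpSlack) : ScenarioCensus.Row_F1 := by
  unfold ScenarioCensus.Row_F1
  intro ν T hν hT u p hsol hLH hdec hTI
  by_contra hext
  exact hext (hD ν T hν hT u p hsol hLH hdec hTI (hR ν T hν hT u p ⟨hsol, hext⟩ hLH hdec hTI))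

/-- The residual is a consequence of the row (vacuously: under `Row_F1` no maximal solution is Type I). -/
theorem ipSlack_of_rowF1 (h : ScenarioCensus.Row_F1) : IpSlack :=
  fun ν T hν hT u p hmax hLH hdec hTI => (hmax.2 (h ν T hν hT u p hmax.1 hLH hdec hTI)).elim

-- `sing_of_not_bounded`: the line restates the tree's `InviscidTop.sing_of_not_bounded`; taken BY NAME (gate lint dedup.landed).

/-! ### Dictionary: the number = `ν^{5/2} ×` the normalised top integrand of the weight-6 read-out `stretchOf` -/

/-- `topIntegrand(stretchOf) = ofReal(√ν · ν⁻³) · productionIntegrand` pointwise (no equation of motion: kinematics). -/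
theorem topIntegrand_stretchOf_eq {ν : ℝ} (hν : 0 < ν) (T : ℝ) (Λ : ℝ → ℝ) (u : ℝ → E3 → E3) (z : ℝ × E3) :
    topIntegrand T ν Λ (fun v L H K => stretchOf v L H K) u z =
      ENNReal.ofReal (Real.sqrt ν * (ν ^ 3)⁻¹) * productionIntegrand T Λ u z := by
  by_cases hz : z ∈ {z : ℝ × E3 | z.1 ∈ Ico 0 T ∧ Λ z.1 < ‖u z.1 z.2‖}
  · rw [topIntegrand, productionIntegrand, indicator_of_mem hz, indicator_of_mem hz,
      ← ENNReal.ofReal_mul (mul_nonneg (Real.sqrt_nonneg ν) (inv_nonneg.2 (pow_nonneg hν.le 3)))]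
    congr 1
    have key := nu_readout_stretchOf hν 1 (u z.1) z.2
    rw [mul_one, one_mul] at key
    have hν3 : ν ^ 3 ≠ 0 := by positivity
    have hI : stretchOf (ν⁻¹ • u z.1 z.2) (ν⁻¹ • fderiv ℝ (u z.1) z.2) (ν⁻¹ • fderiv ℝ (fderiv ℝ (u z.1)) z.2)
        (ν⁻¹ • lapD (u z.1) z.2) = (ν ^ 3)⁻¹ * ⟪curl (u z.1) z.2, convect (curl (u z.1)) (u z.1) z.2⟫ := by
      rw [eq_inv_mul_iff_mul_eq₀ hν3]
      exact key
    have hmax : ∀ P : ℝ, max 0 ((ν ^ 3)⁻¹ * P) = (ν ^ 3)⁻¹ * max 0 P := fun P => by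
      rw [mul_max_of_nonneg _ _ (inv_nonneg.2 (pow_nonneg hν.le 3)), mul_zero]
    rw [hI, Real.sqrt_mul hν.le, hmax]
    ring
  · rw [topIntegrand, productionIntegrand, indicator_of_notMem hz, indicator_of_notMem hz, mul_zero]

/-- `∫ topIntegrand(stretchOf) = ν^{-5/2} ∫ productionIntegrand`. -/
theorem lintegral_topIntegrand_stretchOf_eq {ν : ℝ} (hν : 0 < ν) (T : ℝ) (Λ : ℝ → ℝ) (u : ℝ → E3 → E3) :
    ∫⁻ z, topIntegrand T ν Λ (fun v L H K => stretchOf v L H K) u z =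
      ENNReal.ofReal (Real.sqrt ν * (ν ^ 3)⁻¹) * ∫⁻ z, productionIntegrand T Λ u z := by
  rw [← lintegral_const_mul' _ _ ENNReal.ofReal_ne_top]
  exact lintegral_congr fun z => topIntegrand_stretchOf_eq hν T Λ u z

/-! ### The row is EXCLUDED; the floor; the residual ≡ `Row_F1` -/

/-- **Criterion row F1ip is EXCLUDED** (in kernel): Type I + an integrably stretched top (measurable subcritical level)
⇒ smooth extension.  Engine: singular zoom at a non-extendable point (`FrozenTop.exists_singularZoom_package₃`) → the INTEGRAL
TRANSFER `integral_transfer₆` (LINE 22: scale-invariant pull-back + shrinking supports + Fatou) gives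
`stretchOf(W, ∇W, ∇²W, K) ≤ 0` wherever `W ≠ 0` → analytic globalisation (`FrozenTop.jointCond_everywhere₄`) → the tree's
stretching-certificate Liouville theorem at `θ = 0` (`StretchedTop.typeI_ancient_eq_zero_of_subcriticalStretching`, LINE 16's bridge) →
`W ≡ 0`, contradicting non-triviality of the zoom limit. -/
theorem rowF1ip_holds : Row_F1ip := by
  intro ν T hν hT u p hsol hLH hdec hTI htop
  obtain ⟨Λ, hΛ, hΛm, hfinP⟩ := htop
  obtain ⟨M, hM⟩ := exists_isTypeIBlowupWith hν hTI
  have hfin : ∫⁻ z, topIntegrand T ν Λ (fun v L H K => stretchOf v L H K) u z < ⊤ := by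
    rw [lintegral_topIntegrand_stretchOf_eq hν T Λ u]
    exact ENNReal.mul_lt_top ENNReal.ofReal_lt_top hfinP
  apply hasSmoothExtensionPast_of_forall_exists_parabolicCylinder hν hT hsol hLH hdec
  intro x₀
  by_contra hno
  obtain ⟨α, β, R, c, W, hα, hβ, hR, hαR, hαν, hcpos, hclim, hW, hpt, hgrad, hhess, hlap, t, ht, y, hne⟩ :=
    FrozenTop.exists_singularZoom_package₃ hν hT hsol hLH hdec hM x₀ (InviscidTop.sing_of_not_bounded hno)
  have hRd := integral_transfer₆ hν hT hsol hW hα hβ hαR hαν hcpos hclim hpt hgrad hhess hlap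
    (Rd := fun v L H K => stretchOf v L H K) continuous_stretchOf (fun a _ v L H K => stretchOf_smul v L H K)
    hΛ hΛm hfin
  have hall := FrozenTop.jointCond_everywhere₄ hW (P := fun _ q => stretchOf q.1 q.2.1 q.2.2.1 q.2.2.2 ≤ 0)
    (fun _ => isClosed_le continuous_stretchOf continuous_const)
    (fun _ => by show stretchOf 0 0 0 0 ≤ 0; rw [stretchOf_zero]) hRd
  refine hne (StretchedTop.typeI_ancient_eq_zero_of_subcriticalStretching zero_lt_one hW (fun s hs y' => ?_) t ht y)
  rw [zero_mul, stretch_eq' (W s) y']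
  exact mul_nonpos_iff.2 (Or.inl ⟨(neg_pos.2 hs).le, hall s hs y'⟩)

/-- **SIGN DISPLAY** (the integrated row contains the all-times `θ = 0` sign row; cf. LINE 16's eventual threshold rows):
Type I + at some measurable subcritical level the vorticity of the fast fluid is nowhere stretched (`⟪ω, Sω⟫ ≤ 0` at
every `Λ`-fast point of `[0, T) × ℝ³`) ⇒ smooth extension — the number of the line vanishes identically. -/
theorem rowF1_signStretchTop : ∀ (ν T : ℝ), 0 < ν → 0 < T → ∀ (u : ℝ → E3 → E3) (p : ℝ → E3 → ℝ),
    IsClassicalNSSolutionOn (Ico 0 T) ν 0 u p → IsLerayHopfOn T ν 0 (u 0) u →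
    HasRapidSpatialDecay (u 0) → IsTypeIBlowup u T →
    (∃ Λ : ℝ → ℝ, IsSubcriticalLevel T Λ ∧ Measurable Λ ∧
      ∀ t ∈ Ico 0 T, ∀ x, Λ t < ‖u t x‖ → ⟪curl (u t) x, convect (curl (u t)) (u t) x⟫ ≤ 0) →
    HasSmoothExtensionPast ν 0 u T := by
  intro ν T hν hT u p hsol hLH hdec hTI htop
  obtain ⟨Λ, hΛ, hΛm, hsign⟩ := htop
  refine rowF1ip_holds ν T hν hT u p hsol hLH hdec hTI ⟨Λ, hΛ, hΛm, ?_⟩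
  have h0 : productionIntegrand T Λ u = fun _ => 0 := by
    funext z
    unfold productionIntegrand
    by_cases hz : z ∈ {z : ℝ × E3 | z.1 ∈ Ico 0 T ∧ Λ z.1 < ‖u z.1 z.2‖}
    · rw [indicator_of_mem hz, max_eq_left (hsign z.1 hz.1 z.2 hz.2), mul_zero, ENNReal.ofReal_zero]
    · rw [indicator_of_notMem hz]
  have hI : ∫⁻ z, productionIntegrand T Λ u z = 0 := by simp [h0]
  show ∫⁻ z, productionIntegrand T Λ u z < ⊤
  rw [hI]
  exact ENNReal.zero_lt_top

/-- **The floor DIVERGENT PRODUCTION holds.** -/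
theorem divergentProduction_holds : DivergentProduction := by
  intro ν T hν hT u p hmax hLH hdec hTI Λ hΛ hΛm
  by_contra hne
  exact hmax.2 (rowF1ip_holds ν T hν hT u p hmax.1 hLH hdec hTI ⟨Λ, hΛ, hΛm, lt_top_iff_ne_top.2 hne⟩)

/-- **DIVERGENT PRODUCTION at constant levels**: for a maximal Type-I Clay blow-up and EVERY speed `Λ`,
`∬_{[0,T)×ℝ³, |u| > Λ} √(T − t) · max(0, ⟪ω, Sω⟫) dx dt = ∞`. -/
theorem divergentProduction_const : ∀ (ν T : ℝ), 0 < ν → 0 < T →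
    ∀ (u : ℝ → E3 → E3) (p : ℝ → E3 → ℝ),
    IsMaximalSmoothSolution ν 0 u p T → IsLerayHopfOn T ν 0 (u 0) u →
    HasRapidSpatialDecay (u 0) → IsTypeIBlowup u T →
    ∀ Λ : ℝ, ∫⁻ z, productionIntegrand T (fun _ => Λ) u z = ⊤ := by
  intro ν T hν hT u p hmax hLH hdec hTI Λ
  exact divergentProduction_holds ν T hν hT u p hmax hLH hdec hTI (fun _ => Λ) (isSubcriticalLevel_const T Λ)
    measurable_const

/-- The residual is EXACTLY row F1 (declared; no movement on `Row_F1` is claimed). -/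
theorem ipSlack_iff_rowF1 : IpSlack ↔ ScenarioCensus.Row_F1 :=
  ⟨rowF1_of rowF1ip_holds, ipSlack_of_rowF1⟩

/-- Deciding direction used by the split. -/
theorem rowF1_of_ipSlack : IpSlack → ScenarioCensus.Row_F1 :=
  rowF1_of rowF1ip_holds

end Summit.NavierStokesRegularity.NavierStokesRegularity.Theorems.ScenarioCensus.IntegratedStretch

end
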